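import Literature.AlgebraicGeometry.PlaneCurves.HessianCovariance
import Mathlib.AlgebraicGeometry.EllipticCurve.Projective.Basic
import HarnessLib

/-!
# The Weierstrass model of the Hesse pencil in characteristic `3`, with zero `(1, −1, 0)` (Artebani–Dolgachev, Remarks 2.1 and 5.5)

Topic `Literature/AlgebraicGeometry/PlaneCurves`, namespace `Literature.AlgebraicGeometry.PlaneCurves`.
Lane `lit-hodgefound`, seat `lit-hodgefound-p37`, row g21-#3; a sequel of the seat's
`HessePencilCharacteristicThree` (g21-#1: `E_t = (X + Y + Z)³ + t·XYZ` when `3 = 0`, nonsingular iff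
`t ≠ 0`, the three base points `(1, −1, 0), (0, 1, −1), (1, 0, −1)` are flexes) and the characteristic-`3`
counterpart of `HessePencilWeierstrassForm` (g16-#4: for `3 ≠ 0`, `H_μ ∘ M_μ = (μ³ − 1)·W_μ`).
Everything here is PROVED (polynomial identities); no definition, no named fact.

Source followed — M. Artebani, I. Dolgachev, *The Hesse pencil of plane cubic curves*,
L'Enseignement Math. (2) 55 (2009) 235–273 [arXiv:math/0611590, held `paper:arxiv-math_0611590`
p0005 L58–L65, p0008 L13, p0011 L46], VERBATIM:

> (Remark 2.1) The Hesse pencil makes sense over a field of any characteristic and is popular in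
> number-theory and cryptography for finding explicit algorithms for computing the number of points
> of an elliptic curve over a finite field of characteristic 3 (see [Ran], [Smart]). […] The Hesse
> pencil (hessep) in characteristic 3 has two singular members: `(x + y + z)³ = 0` and `xyz = 0`. It
> has three base points `(1, −1, 0), (0, 1, −1), (1, 0, −1)` […] which are the inflection points of
> all nonsingular members of the pencil.
> (§4) `g₁(x, y, z) = (y, z, x)`.
> (Remark 5.5) In characteristic 3 the cyclic group of projective transformations generated by `g₁`
> acts on nonsingular members of the Hesse pencil as translation by 3-torsion points with the zero
> point taken to be `(1, −1, 0)`.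

## What is formalised

The member `E_t = X³ + Y³ + Z³ + t·XYZ` (local notation `𝐄[t]`); `K` a field, "characteristic `3`" is
the hypothesis `(3 : K) = 0`.  Taking, as the source does, the base point `o = (1, −1, 0)` as the zero
— a flex of every nonsingular member, with inflection tangent `z = 0` — the linear substitution
`x = t⁻¹Y`, `y = X − t⁻¹Y`, `z = tZ`, i.e. the matrix `M_t = [[0, t⁻¹, 0], [1, −t⁻¹, 0], [0, 0, t]]`
(local notation `𝐌[t]`), carries `E_t` (`t ≠ 0`) to MATHLIB'S Weierstrass cubic with
`(a₁, a₂, a₃, a₄, a₆) = (−t, 0, 0, 0, t³)`, i.e. `Y²Z − tXYZ = X³ + t³Z³` (local notation `𝐖₃[t]`),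
and `M_t (0, 1, 0) = t⁻¹·(1, −1, 0)`: Mathlib's zero `O` goes to the source's zero point.  This puts
"nonsingular members", "3-torsion points" and "translation" of Remark 5.5 inside Mathlib's group
`WeierstrassCurve.Affine.Point` exactly as `HessePencilGroupLaw` did for `3 ≠ 0`.

* §1 (any commutative ring / any field) `hesseE_bind₁_g₁` (`E_t ∘ g₁ = E_t`: "the cyclic group generated
  by `g₁` acts on [the] members"), `hesseE_eval_zero_point` (`o = (1, −1, 0)` lies on every `E_t`).
* §2 (`3 = 0`, `t ≠ 0`) **`hesseE_bind₁_charThree`**: `E_t ∘ M_t = −W₃[t]` with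
  `W₃[t] = ⟨−t, 0, 0, 0, t³⟩`; `charThree_matrix_det` (`det M_t = −1`), `charThree_matrix_mulVec_O`
  (`M_t (0,1,0) = t⁻¹·(1,−1,0)` — "the zero point taken to be `(1, −1, 0)`"), `hesseE_eval_charThree_mulVec`
  (pointwise: `E_t(M_t v) = −W₃[t](v)`, so `v ↦ M_t v` carries the points of `W₃[t]` onto points of `E_t`).
* §3 (`3 = 0`) the invariants of `W₃[t]`: `charThree_weierstrass_b` (`b₂ = t²`, `b₄ = 0`, `b₆ = t³`,
  `b₈ = t⁵`), `charThree_weierstrass_c₄` (`c₄ = t⁴`, any characteristic), **`charThree_weierstrass_Δ`** (`Δ = −t⁹`),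
  **`charThree_weierstrass_isElliptic_iff`** (`W₃[t]` is elliptic iff `t ≠ 0` — Remark 2.1's
  "nonsingular members" once more, now in Mathlib's sense), and `charThree_weierstrass_j`
  (`j(E_t) = −t³` for `t ≠ 0`; this value is a computation on Mathlib's formulas, recorded for the
  sequel, not a sentence of the source — compare Remark 5.5's `λ = λ′³`).

NOT here: the translation statement of Remark 5.5 itself (that `g₁`, read through `M_t`, is
`P ↦ P + T` for the `3`-torsion point `T` over `(1, 0, −1)`) — it needs the chord–tangent transport of
`HessePencilGroupLaw` redone for `M_t`; [Ran], [Smart].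

## References
* [ArtebaniDolgachev2009] M. Artebani, I. Dolgachev, *The Hesse pencil of plane cubic curves*,
  Enseign. Math. (2) 55 (2009) 235–273, §2 Remark 2.1, §4 (`g₁`), §5 Remark 5.5.
-/

set_option autoImplicit false

open MvPolynomial Matrix
open Literature.AlgebraicGeometry.HyperbolicPolynomials

namespace Literature.AlgebraicGeometry.PlaneCurves

universe u

/-- The member `E_t = X³ + Y³ + Z³ + t·XYZ` of the Hesse pencil (local notation, no definition). -/
local notation3 "𝐄[" t "]" =>
  (X 0 ^ 3 + X 1 ^ 3 + X 2 ^ 3 + C t * (X 0 * X 1 * X 2) : MvPolynomial (Fin 3) _)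

/-- `g₁ = (y, z, x)` as a substitution matrix (local notation as in `HessePencilHessianGroup`). -/
local notation3 "𝐠₁" => (Matrix.of ![![(0 : _), 1, 0], ![0, 0, 1], ![1, 0, 0]] : Matrix (Fin 3) (Fin 3) _)

/-- The characteristic-`3` substitution `M_t = [[0, t⁻¹, 0], [1, −t⁻¹, 0], [0, 0, t]]`
(`x = t⁻¹Y`, `y = X − t⁻¹Y`, `z = tZ`; local notation, no definition). -/
local notation3 "𝐌[" t "]" =>
  (Matrix.of ![![(0 : _), t⁻¹, 0], ![1, -t⁻¹, 0], ![0, 0, t]] : Matrix (Fin 3) (Fin 3) _)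

/-- The characteristic-`3` Weierstrass model `Y²Z − tXYZ = X³ + t³Z³` of `E_t` (local notation). -/
local notation3 "𝐖₃[" t "]" =>
  ({ a₁ := -t, a₂ := 0, a₃ := 0, a₄ := 0, a₆ := t ^ 3 } : WeierstrassCurve _)

section CharThreeModel

variable {K : Type u} [Field K]

/-- The linear forms of a `3 × 3` substitution, written out. [folklore] -/
private theorem toMvPolynomial_fin_three₃ (M : Matrix (Fin 3) (Fin 3) K) (i : Fin 3) :
    M.toMvPolynomial i = C (M i 0) * X 0 + C (M i 1) * X 1 + C (M i 2) * X 2 := by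
  simp only [Matrix.toMvPolynomial, Fin.sum_univ_three, ← C_mul_X_eq_monomial]

/-! ## §1 `g₁` preserves every member; the zero point `(1, −1, 0)` -/

/-- **"the cyclic group of projective transformations generated by `g₁` acts on [the] members of the
Hesse pencil"**: `E_t ∘ g₁ = E_t` in `K[X, Y, Z]` for every `t` (any field, any characteristic;
`g₁(x, y, z) = (y, z, x)`). [cite: ArtebaniDolgachev2009, §5, Remark 5.5; §4 (`g₁`)] -/
theorem hesseE_bind₁_g₁ (t : K) :
    bind₁ (𝐠₁ : Matrix (Fin 3) (Fin 3) K).toMvPolynomial 𝐄[t] = 𝐄[t] := by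
  simp only [map_add, map_mul, map_pow, bind₁_X_right, bind₁_C_right, toMvPolynomial_fin_three₃]
  simp
  ring

/-- **"the zero point taken to be `(1, −1, 0)`"**: `o = (1, −1, 0)` lies on every member `E_t` (any
field). [cite: ArtebaniDolgachev2009, §5, Remark 5.5; §2, Remark 2.1 (the base point `(1, −1, 0)`)] -/
theorem hesseE_eval_zero_point (t : K) : eval ![(1 : K), -1, 0] 𝐄[t] = 0 := by
  simp; norm_num

/-! ## §2 The model: `E_t ∘ M_t = −W₃[t]` for `3 = 0`, `t ≠ 0` -/

/-- **The Weierstrass model of `E_t` in characteristic `3`**: for `3 = 0` and `t ≠ 0`,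
`E_t ∘ M_t = −(Y²Z + a₁XYZ + a₃YZ² − (X³ + a₂X²Z + a₄XZ² + a₆Z³))` with
`(a₁, a₂, a₃, a₄, a₆) = (−t, 0, 0, 0, t³)`, i.e. `E_t(t⁻¹Y, X − t⁻¹Y, tZ) = −(Y²Z − tXYZ − X³ − t³Z³)`
(use `(x + y)³ = x³ + y³` in characteristic `3`: `x³ + y³ = X³`, `z³ = t³Z³`, `t·xyz = tXYZ − Y²Z`) —
the members `t ≠ 0` of Remark 2.1 as Mathlib Weierstrass cubics, normalised at the zero point
`(1, −1, 0)` of Remark 5.5. [cite: ArtebaniDolgachev2009, §2, Remark 2.1; §5, Remark 5.5] -/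
theorem hesseE_bind₁_charThree (h3 : (3 : K) = 0) {t : K} (ht : t ≠ 0) :
    bind₁ (𝐌[t] : Matrix (Fin 3) (Fin 3) K).toMvPolynomial 𝐄[t] =
      -(𝐖₃[t] : WeierstrassCurve K).toProjective.polynomial := by
  have h3' : (3 : MvPolynomial (Fin 3) K) = 0 := by
    rw [← map_ofNat C 3, show (OfNat.ofNat 3 : K) = 0 from h3, C_0]
  have hCt : (C t : MvPolynomial (Fin 3) K) * C t⁻¹ = 1 := by rw [← map_mul, mul_inv_cancel₀ ht, map_one]
  simp only [map_add, map_mul, map_pow, bind₁_X_right, bind₁_C_right, toMvPolynomial_fin_three₃,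
    WeierstrassCurve.Projective.polynomial]
  simp [map_neg]
  linear_combination (-(C t⁻¹ * X 0 ^ 2 * X 1) + C t⁻¹ ^ 2 * X 0 * X 1 ^ 2) * h3' +
    (C t * (X 0 * X 1 * X 2) - (C t * C t⁻¹ + 1) * (X 1 ^ 2 * X 2)) * hCt

/-- `det M_t = −1` (`t ≠ 0`): the substitution is invertible. [cite: ArtebaniDolgachev2009, §2,
Remark 2.1 (nonsingular members `t ≠ 0`)] -/
theorem charThree_matrix_det {t : K} (ht : t ≠ 0) :
    (𝐌[t] : Matrix (Fin 3) (Fin 3) K).det = -1 := by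
  rw [Matrix.det_fin_three]
  simp [inv_mul_cancel₀ ht]

/-- **"with the zero point taken to be `(1, −1, 0)`"**: `M_t` carries Mathlib's point at infinity
`(0, 1, 0)` to `t⁻¹·(1, −1, 0)`, the source's zero point. [cite: ArtebaniDolgachev2009, §5, Remark 5.5] -/
theorem charThree_matrix_mulVec_O (t : K) :
    (𝐌[t] : Matrix (Fin 3) (Fin 3) K) *ᵥ ![0, 1, 0] = t⁻¹ • ![(1 : K), -1, 0] := by
  ext j
  fin_cases j <;> simp [Matrix.mulVec, dotProduct, Fin.sum_univ_three]

/-- **Points of `W₃[t]` go to points of `E_t`**: for `3 = 0`, `t ≠ 0` and every `v`,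
`E_t(M_t v) = −W₃[t](v)`; in particular `v ↦ M_t v` carries the zero set of the Weierstrass cubic
into the member `E_t`. [cite: ArtebaniDolgachev2009, §2, Remark 2.1; §5, Remark 5.5] -/
theorem hesseE_eval_charThree_mulVec (h3 : (3 : K) = 0) {t : K} (ht : t ≠ 0) (v : Fin 3 → K) :
    eval ((𝐌[t] : Matrix (Fin 3) (Fin 3) K) *ᵥ v) 𝐄[t] =
      -eval v (𝐖₃[t] : WeierstrassCurve K).toProjective.polynomial := by
  rw [← eval_bind₁_toMvPolynomial, hesseE_bind₁_charThree h3 ht, map_neg]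

/-! ## §3 The invariants of `W₃[t]`: `Δ = −t⁹`, elliptic iff `t ≠ 0`, `j = −t³` -/

/-- The `b`-invariants of `W₃[t] = ⟨−t, 0, 0, 0, t³⟩` in characteristic `3`: `b₂ = t²`, `b₄ = 0`,
`b₆ = t³` (`4 = 1`), `b₈ = t⁵`. [cite: ArtebaniDolgachev2009, §2, Remark 2.1 (the nonsingular members
in characteristic `3`)] -/
theorem charThree_weierstrass_b (h3 : (3 : K) = 0) (t : K) :
    (𝐖₃[t] : WeierstrassCurve K).b₂ = t ^ 2 ∧ (𝐖₃[t] : WeierstrassCurve K).b₄ = 0 ∧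
      (𝐖₃[t] : WeierstrassCurve K).b₆ = t ^ 3 ∧ (𝐖₃[t] : WeierstrassCurve K).b₈ = t ^ 5 := by
  simp only [WeierstrassCurve.b₂, WeierstrassCurve.b₄, WeierstrassCurve.b₆, WeierstrassCurve.b₈]
  refine ⟨by ring, by ring, ?_, by ring⟩
  linear_combination t ^ 3 * h3

/-- `c₄(W₃[t]) = t⁴` (any characteristic: `b₄ = 0`). [cite: ArtebaniDolgachev2009, §2, Remark 2.1] -/
theorem charThree_weierstrass_c₄ (t : K) :
    (𝐖₃[t] : WeierstrassCurve K).c₄ = t ^ 4 := by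
  simp only [WeierstrassCurve.c₄, WeierstrassCurve.b₂, WeierstrassCurve.b₄]
  ring

/-- **The discriminant of the characteristic-`3` model: `Δ(W₃[t]) = −t⁹`** (`3 = 0`; so the members
`t ≠ 0` are exactly the nonsingular ones, Remark 2.1). [cite: ArtebaniDolgachev2009, §2, Remark 2.1
("two singular members")] -/
theorem charThree_weierstrass_Δ (h3 : (3 : K) = 0) (t : K) :
    (𝐖₃[t] : WeierstrassCurve K).Δ = -t ^ 9 := by
  simp only [WeierstrassCurve.Δ, WeierstrassCurve.b₂, WeierstrassCurve.b₄, WeierstrassCurve.b₆,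
    WeierstrassCurve.b₈]
  linear_combination (-144 * t ^ 6) * h3

/-- **`W₃[t]` is an elliptic curve iff `t ≠ 0`** (`3 = 0`): Remark 2.1's nonsingular members in
Mathlib's sense `WeierstrassCurve.IsElliptic`. [cite: ArtebaniDolgachev2009, §2, Remark 2.1] -/
theorem charThree_weierstrass_isElliptic_iff (h3 : (3 : K) = 0) (t : K) :
    (𝐖₃[t] : WeierstrassCurve K).IsElliptic ↔ t ≠ 0 := by
  rw [WeierstrassCurve.isElliptic_iff, charThree_weierstrass_Δ h3, isUnit_iff_ne_zero, neg_ne_zero,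
    pow_ne_zero_iff (by norm_num)]

/-- **The `j`-invariant of `E_t` in characteristic `3`: `j(W₃[t]) = −t³`** (`3 = 0`, `t ≠ 0`;
`j = c₄³/Δ = t¹²/(−t⁹)`).  A computation on Mathlib's formulas for the cited model, recorded for the
sequel (the source prints no `j`-value in characteristic `3`; compare its `λ = λ′³` of Remark 5.5).
[cite: ArtebaniDolgachev2009, §2, Remark 2.1; §5, Remark 5.5] -/
theorem charThree_weierstrass_j (h3 : (3 : K) = 0) {t : K} (ht : t ≠ 0) :
    haveI := (charThree_weierstrass_isElliptic_iff h3 t).2 ht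
    (𝐖₃[t] : WeierstrassCurve K).j = -t ^ 3 := by
  rw [WeierstrassCurve.j, Units.val_inv_eq_inv_val, WeierstrassCurve.coe_Δ', charThree_weierstrass_Δ h3,
    charThree_weierstrass_c₄]
  field_simp

end CharThreeModel

end Literature.AlgebraicGeometry.PlaneCurves
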